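import Literature.Topology.FourManifolds.GluingConstructionMaps
import Literature.Topology.FourManifolds.MorseChartChangeInterior
import Literature.Topology.FourManifolds.InteriorTangent
import Literature.Topology.FourManifolds.OpenCollar
import HarnessLib

/-!
# Seam gluing of Morse functions, II: transport of Morse data

Helper file (lead c1, crux `ConvexBisection.AcyclicBisectionRigidity`, item
stmt-SmoothPoincare4-10507).  Three pieces of bookkeeping for the glued Morse function of
`M ∪_φ N` (Milnor, *Morse theory* (1963), §2: critical points, nondegeneracy and the index are
read in any chart):

* along a DIFFEOMORPHISM `Φ : P ≅ P'` of manifolds without boundary: `F ∘ Φ` is critical at `x`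
  iff `F` is critical at `Φ x`, with the same Morse index and nondegeneracy; hence `F ∘ Φ` is Morse
  iff `F` is, `Crit_k (F ∘ Φ) = Φ⁻¹ (Crit_k F)` and the counts agree
  (`isMCriticalPt_comp_diffeomorph_iff`, `morseIndex_comp_diffeomorph`, `IsMorse.comp_diffeomorph`,
  `criticalSetOfIndex_comp_diffeomorph`, `ncard_criticalSetOfIndex_comp_diffeomorph`) — the chart
  `c ∘ Φ` transported along `Φ` lies in the maximal atlas (`trans_mem_maximalAtlas_of_diffeomorph`);
* along the inclusion `val : M - ∂M → M` of the INTERIOR (`InteriorManifold`, whose charts are those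
  of `M`): same critical points, Hessians and indices (`InteriorManifold.isMCriticalPt_comp_val_iff`,
  `InteriorManifold.mhessian_comp_val`, `InteriorManifold.morseIndex_comp_val`);
* on the two pieces of an open gluing `A ∪_ψ B` (`SmoothGlueData`, boundaryless pieces): the Morse
  index at `inl a` / `inr b` is that of `F ∘ inl` at `a` / `F ∘ inr` at `b`
  (`SmoothGlueData.morseIndex_inl_eq`, `SmoothGlueData.morseIndex_inr_eq`; the nondegeneracy twins
  are the tree's `nondegenerate_mhessian_inl_iff` / `…inr_iff`).

Everything is proved; no definitions. [folklore]
-/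

noncomputable section

open scoped Manifold ContDiff Topology
open Set Function Filter Literature.Topology.FourManifolds

-- the prescribed namespace `Summit.<P>.<Sub>.…` duplicates `SmoothPoincare4` (P = Sub)
set_option linter.dupNamespace false

namespace Summit.SmoothPoincare4.SmoothPoincare4.Theorems.AcyclicBisectionRigidity.SeamGluing

/-! ### Transport along a diffeomorphism (manifolds without boundary) -/

section Diffeo

variable {E H : Type*} [NormedAddCommGroup E] [NormedSpace ℝ E] [TopologicalSpace H]
  {I : ModelWithCorners ℝ E H}
  {P : Type*} [TopologicalSpace P] [ChartedSpace H P]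
  {P' : Type*} [TopologicalSpace P'] [ChartedSpace H P']

/-- **A diffeomorphism pulls critical points back** (chain rule: `d(F ∘ Φ)ₓ = dF_{Φ x} ∘ dΦₓ`).
[cite: Milnor1963, §2] -/
theorem isMCriticalPt_comp_diffeomorph {Φ : P ≃ₘ⟮I, I⟯ P'} {F : P' → ℝ} {x : P}
    (hF : MDifferentiableAt I 𝓘(ℝ, ℝ) F (Φ x)) (h : IsMCriticalPt I F (Φ x)) :
    IsMCriticalPt I (F ∘ Φ) x := by
  have hΦ : MDifferentiableAt I I Φ x := Φ.contMDiff.mdifferentiableAt (by simp)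
  unfold IsMCriticalPt at h ⊢
  rw [mfderiv_comp x hF hΦ, h]
  exact ContinuousLinearMap.zero_comp _

/-- **Critical points correspond along a diffeomorphism**: `F ∘ Φ` is critical at `x` iff `F` is
critical at `Φ x` (for `F` differentiable there). [cite: Milnor1963, §2] -/
theorem isMCriticalPt_comp_diffeomorph_iff (Φ : P ≃ₘ⟮I, I⟯ P') {F : P' → ℝ} {x : P}
    (hF : MDifferentiableAt I 𝓘(ℝ, ℝ) F (Φ x)) :
    IsMCriticalPt I (F ∘ Φ) x ↔ IsMCriticalPt I F (Φ x) := by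
  refine ⟨fun h => ?_, isMCriticalPt_comp_diffeomorph hF⟩
  have hΦ : MDifferentiableAt I I Φ x := Φ.contMDiff.mdifferentiableAt (by simp)
  have hFΦ : MDifferentiableAt I 𝓘(ℝ, ℝ) (F ∘ Φ) (Φ.symm (Φ x)) := by
    rw [Φ.symm_apply_apply]; exact hF.comp x hΦ
  have h' : IsMCriticalPt I (F ∘ Φ) (Φ.symm (Φ x)) := by rwa [Φ.symm_apply_apply]
  have key := isMCriticalPt_comp_diffeomorph (Φ := Φ.symm) hFΦ h'
  have heq : (F ∘ Φ) ∘ Φ.symm = F := by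
    funext y; simp
  rwa [heq] at key

/-- **The chart Hessian in a transported chart**: reading `F ∘ Φ` in the chart `c ∘ Φ` of `P` is
reading `F` in the chart `c` of `P'` (same formula, same point). [cite: Milnor1963, §2] -/
theorem hessianInChart_trans_diffeomorph (Φ : P ≃ₘ⟮I, I⟯ P') (c : OpenPartialHomeomorph P' H)
    (F : P' → ℝ) (x : P) :
    hessianInChart I (Φ.toHomeomorph.toOpenPartialHomeomorph ≫ₕ c) (F ∘ Φ) x =
      hessianInChart I c F (Φ x) := by
  have hsymm : ((F ∘ Φ) ∘ ((Φ.toHomeomorph.toOpenPartialHomeomorph ≫ₕ c).extend I).symm) =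
      (F ∘ (c.extend I).symm) := by
    funext z
    simp only [comp_apply, OpenPartialHomeomorph.extend, PartialEquiv.coe_trans_symm,
      OpenPartialHomeomorph.coe_toPartialEquiv_symm, OpenPartialHomeomorph.trans_symm_eq_symm_trans_symm,
      OpenPartialHomeomorph.coe_trans, Homeomorph.toOpenPartialHomeomorph_symm_apply,
      ModelWithCorners.toPartialEquiv_coe_symm]
    exact congrArg F (Φ.apply_symm_apply _)
  have hpt : (Φ.toHomeomorph.toOpenPartialHomeomorph ≫ₕ c).extend I x = c.extend I (Φ x) := by
    simp [OpenPartialHomeomorph.extend]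
  ext v w
  rw [hessianInChart_apply_apply, hessianInChart_apply_apply, hsymm, hpt]

variable [I.Boundaryless] [IsManifold I ∞ P] [IsManifold I ∞ P']

/-- **The Morse index is invariant under diffeomorphisms**: at a critical point,
`index_x (F ∘ Φ) = index_{Φ x} F` (the index is read in the chart `chartAt (Φ x) ∘ Φ` of the
maximal atlas of `P`, where `F ∘ Φ` reads as `F` in `chartAt (Φ x)`). [cite: Milnor1963, §2] -/
theorem morseIndex_comp_diffeomorph (Φ : P ≃ₘ⟮I, I⟯ P') {F : P' → ℝ} {x : P}
    (hF : ContMDiffAt I 𝓘(ℝ, ℝ) 2 F (Φ x)) (hc : IsMCriticalPt I F (Φ x)) :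
    morseIndex I (F ∘ Φ) x = morseIndex I F (Φ x) := by
  haveI : IsManifold I 2 P := IsManifold.of_le (n := ∞) (by norm_cast)
  haveI : IsManifold I 2 P' := IsManifold.of_le (n := ∞) (by norm_cast)
  set e := Φ.toHomeomorph.toOpenPartialHomeomorph ≫ₕ chartAt H (Φ x) with he_def
  have heInf : e ∈ IsManifold.maximalAtlas I ∞ P :=
    trans_mem_maximalAtlas_of_diffeomorph Φ (IsManifold.chart_mem_maximalAtlas (Φ x))
  have he : e ∈ IsManifold.maximalAtlas I 2 P :=
    IsManifold.maximalAtlas_subset_of_le (M := P) (by norm_cast) heInf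
  have hxe : x ∈ e.source := by
    simp [he_def]
  have hFΦ : ContMDiffAt I 𝓘(ℝ, ℝ) 2 (F ∘ Φ) x :=
    hF.comp x (Φ.contMDiff.contMDiffAt.of_le (by norm_cast))
  have hcΦ : IsMCriticalPt I (F ∘ Φ) x :=
    isMCriticalPt_comp_diffeomorph (hF.mdifferentiableAt (by norm_cast)) hc
  rw [morseIndex_eq_sigNeg_hessianInChart hFΦ hcΦ he hxe, he_def, hessianInChart_trans_diffeomorph,
    hessianInChart_chartAt]
  rfl

/-- **Nondegeneracy of the Hessian is invariant under diffeomorphisms.** [cite: Milnor1963, §2] -/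
theorem nondegenerate_mhessian_comp_diffeomorph_iff (Φ : P ≃ₘ⟮I, I⟯ P') {F : P' → ℝ} {x : P}
    (hF : ContMDiffAt I 𝓘(ℝ, ℝ) 2 F (Φ x)) (hc : IsMCriticalPt I F (Φ x)) :
    (mhessian I (F ∘ Φ) x).Nondegenerate ↔ (mhessian I F (Φ x)).Nondegenerate := by
  haveI : IsManifold I 2 P := IsManifold.of_le (n := ∞) (by norm_cast)
  haveI : IsManifold I 2 P' := IsManifold.of_le (n := ∞) (by norm_cast)
  set e := Φ.toHomeomorph.toOpenPartialHomeomorph ≫ₕ chartAt H (Φ x) with he_def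
  have heInf : e ∈ IsManifold.maximalAtlas I ∞ P :=
    trans_mem_maximalAtlas_of_diffeomorph Φ (IsManifold.chart_mem_maximalAtlas (Φ x))
  have he : e ∈ IsManifold.maximalAtlas I 2 P :=
    IsManifold.maximalAtlas_subset_of_le (M := P) (by norm_cast) heInf
  have hxe : x ∈ e.source := by
    simp [he_def]
  have hFΦ : ContMDiffAt I 𝓘(ℝ, ℝ) 2 (F ∘ Φ) x :=
    hF.comp x (Φ.contMDiff.contMDiffAt.of_le (by norm_cast))
  have hcΦ : IsMCriticalPt I (F ∘ Φ) x :=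
    isMCriticalPt_comp_diffeomorph (hF.mdifferentiableAt (by norm_cast)) hc
  rw [nondegenerate_mhessian_iff hFΦ hcΦ he hxe, he_def, hessianInChart_trans_diffeomorph,
    hessianInChart_chartAt]

/-- **Morse functions pull back along diffeomorphisms.** [cite: Milnor1963, §2] -/
theorem IsMorse.comp_diffeomorph (Φ : P ≃ₘ⟮I, I⟯ P') {F : P' → ℝ} (hF : IsMorse I F) :
    IsMorse I (F ∘ Φ) := by
  refine ⟨hF.contMDiff.comp Φ.contMDiff, fun x hx => ?_⟩
  have hd : MDifferentiableAt I 𝓘(ℝ, ℝ) F (Φ x) := hF.contMDiff.mdifferentiableAt (by simp)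
  have hc : IsMCriticalPt I F (Φ x) := (isMCriticalPt_comp_diffeomorph_iff Φ hd).1 hx
  exact (nondegenerate_mhessian_comp_diffeomorph_iff Φ (hF.contMDiff.contMDiffAt.of_le (by norm_cast))
    hc).2 (hF.nondegenerate hc)

/-- **`Crit_k (F ∘ Φ) = Φ⁻¹ (Crit_k F)`** for a smooth `F`. [cite: Milnor1963, §2] -/
theorem criticalSetOfIndex_comp_diffeomorph (Φ : P ≃ₘ⟮I, I⟯ P') {F : P' → ℝ}
    (hF : ContMDiff I 𝓘(ℝ, ℝ) ∞ F) (k : ℕ) :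
    criticalSetOfIndex I (F ∘ Φ) k = Φ ⁻¹' criticalSetOfIndex I F k := by
  ext x
  simp only [mem_criticalSetOfIndex, mem_preimage]
  have hd : MDifferentiableAt I 𝓘(ℝ, ℝ) F (Φ x) := hF.mdifferentiableAt (by simp)
  rw [isMCriticalPt_comp_diffeomorph_iff Φ hd]
  constructor
  · rintro ⟨hc, hk⟩
    exact ⟨hc, by rw [← morseIndex_comp_diffeomorph Φ (hF.contMDiffAt.of_le (by norm_cast)) hc, hk]⟩
  · rintro ⟨hc, hk⟩
    exact ⟨hc, by rw [morseIndex_comp_diffeomorph Φ (hF.contMDiffAt.of_le (by norm_cast)) hc, hk]⟩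

/-- **The number of critical points of each index is a diffeomorphism invariant.** [cite: Milnor1963, §2] -/
theorem ncard_criticalSetOfIndex_comp_diffeomorph (Φ : P ≃ₘ⟮I, I⟯ P') {F : P' → ℝ}
    (hF : ContMDiff I 𝓘(ℝ, ℝ) ∞ F) (k : ℕ) :
    (criticalSetOfIndex I (F ∘ Φ) k).ncard = (criticalSetOfIndex I F k).ncard := by
  have hinj : Function.Injective (Φ.symm : P' → P) := Φ.symm.injective
  rw [criticalSetOfIndex_comp_diffeomorph Φ hF k,
    ← image_eq_preimage_of_inverse Φ.apply_symm_apply Φ.symm_apply_apply,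
    ncard_image_of_injective _ hinj]

end Diffeo

/-! ### Along the inclusion of the interior -/

section Interior

variable {E H : Type*} [NormedAddCommGroup E] [NormedSpace ℝ E] [TopologicalSpace H]
  {I : ModelWithCorners ℝ E H} {M : Type*} [TopologicalSpace M] [ChartedSpace H M]
  [IsManifold I ∞ M]

/-- **`f ∘ val` is critical at `x` iff `f` is critical at `x.val`** (`D val = id`). [cite: Milnor1963, §2] -/
theorem InteriorManifold.isMCriticalPt_comp_val_iff {f : M → ℝ} (x : InteriorManifold I M)
    (hf : MDifferentiableAt I 𝓘(ℝ, ℝ) f x.val) :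
    IsMCriticalPt 𝓘(ℝ, E) (f ∘ (InteriorManifold.val : InteriorManifold I M → M)) x ↔
      IsMCriticalPt I f x.val := by
  unfold IsMCriticalPt
  rw [mfderiv_comp x hf (InteriorManifold.mdifferentiableAt_val x), InteriorManifold.mfderiv_val]
  erw [ContinuousLinearMap.comp_id]
  exact Iff.rfl

/-- In the preferred extended charts (which agree), `f ∘ val` and `f` read as the same function
near the chart image of an interior point. [folklore] -/
theorem InteriorManifold.writtenInExtChartAt_comp_val_eventuallyEq (f : M → ℝ) (x : InteriorManifold I M) :
    writtenInExtChartAt 𝓘(ℝ, E) 𝓘(ℝ, ℝ) x (f ∘ (InteriorManifold.val : InteriorManifold I M → M))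
      =ᶠ[𝓝 (extChartAt I x.val x.val)] writtenInExtChartAt I 𝓘(ℝ, ℝ) x.val f := by
  filter_upwards [InteriorManifold.extChartAt_target_mem_nhds' x] with u hu
  simp only [writtenInExtChartAt, comp_apply, extChartAt_self_apply]
  rw [InteriorManifold.extChartAt_symm_apply_val x hu]

/-- **The Hessian of `f ∘ val` at `x` is the Hessian of `f` at `x.val`** (both are plain second
derivatives of the same written function, the chart image being interior). [cite: Milnor1963, §2] -/
theorem InteriorManifold.mhessian_comp_val (f : M → ℝ) (x : InteriorManifold I M) :
    mhessian 𝓘(ℝ, E) (f ∘ (InteriorManifold.val : InteriorManifold I M → M)) x = mhessian I f x.val := by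
  ext v w
  have h1 : fderiv ℝ (fderiv ℝ (writtenInExtChartAt 𝓘(ℝ, E) 𝓘(ℝ, ℝ) x
      (f ∘ (InteriorManifold.val : InteriorManifold I M → M)))) (extChartAt I x.val x.val) =
      fderiv ℝ (fderiv ℝ (writtenInExtChartAt I 𝓘(ℝ, ℝ) x.val f)) (extChartAt I x.val x.val) :=
    ((InteriorManifold.writtenInExtChartAt_comp_val_eventuallyEq f x).fderiv (𝕜 := ℝ)).fderiv_eq
  rw [mhessian_apply_eq_fderiv_fderiv_of_isInteriorPoint' x.property v w, ← h1,
    mhessian_apply_eq_fderiv_fderiv_of_isInteriorPoint' (I := 𝓘(ℝ, E))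
      (BoundarylessManifold.isInteriorPoint (I := 𝓘(ℝ, E))) v w, InteriorManifold.extChartAt_apply]

/-- **The Morse index of `f ∘ val` at `x` is that of `f` at `x.val`.** [cite: Milnor1963, §2] -/
theorem InteriorManifold.morseIndex_comp_val (f : M → ℝ) (x : InteriorManifold I M) :
    morseIndex 𝓘(ℝ, E) (f ∘ (InteriorManifold.val : InteriorManifold I M → M)) x = morseIndex I f x.val := by
  unfold morseIndex
  rw [InteriorManifold.mhessian_comp_val]

/-- Nondegeneracy of the Hessian of `f ∘ val` at `x` is that of `f` at `x.val`. [cite: Milnor1963, §2] -/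
theorem InteriorManifold.nondegenerate_mhessian_comp_val_iff (f : M → ℝ) (x : InteriorManifold I M) :
    (mhessian 𝓘(ℝ, E) (f ∘ (InteriorManifold.val : InteriorManifold I M → M)) x).Nondegenerate ↔
      (mhessian I f x.val).Nondegenerate := by
  rw [InteriorManifold.mhessian_comp_val]

end Interior

/-! ### On the pieces of an open gluing (Morse index) -/

section Glue

universe uA uB

variable {E_A H_A E_B H_B : Type*}
  [NormedAddCommGroup E_A] [NormedSpace ℝ E_A] [TopologicalSpace H_A]
  [NormedAddCommGroup E_B] [NormedSpace ℝ E_B] [TopologicalSpace H_B]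
  {I_A : ModelWithCorners ℝ E_A H_A} {I_B : ModelWithCorners ℝ E_B H_B}
  {A : Type uA} [TopologicalSpace A] [ChartedSpace H_A A]
  {B : Type uB} [TopologicalSpace B] [ChartedSpace H_B B]
  {E_P : Type*} [NormedAddCommGroup E_P] [NormedSpace ℝ E_P]
  {d : SmoothGlueData I_A I_B A B E_P}
  [I_A.Boundaryless] [I_B.Boundaryless] [IsManifold I_A ∞ A] [IsManifold I_B ∞ B]
  [IsManifold 𝓘(ℝ, E_P) 2 d.Glued]

/-- **The Morse index of `F : A ∪_ψ B → ℝ` at a critical point `inl a` is that of `F ∘ inl` at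
`a`** (index read in the lifted chart `chartA (chartAt a)`, congruent to the chart Hessian of
`F ∘ inl` by the linear identification `linA`; Sylvester). [cite: Milnor1963, §2] -/
theorem SmoothGlueData.morseIndex_inl_eq {F : d.Glued → ℝ} {a : A}
    (hF : ContMDiffAt 𝓘(ℝ, E_P) 𝓘(ℝ, ℝ) 2 F (d.inl a)) (hc : IsMCriticalPt 𝓘(ℝ, E_P) F (d.inl a)) :
    morseIndex 𝓘(ℝ, E_P) F (d.inl a) = morseIndex I_A (F ∘ d.inl) a := by
  haveI : IsManifold I_A 2 A := IsManifold.of_le (n := ∞) (by norm_cast)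
  have he : chartAt H_A a ∈ IsManifold.maximalAtlas I_A ∞ A := IsManifold.chart_mem_maximalAtlas a
  have he2 : d.chartA (chartAt H_A a) ∈ IsManifold.maximalAtlas 𝓘(ℝ, E_P) 2 d.Glued :=
    IsManifold.maximalAtlas_subset_of_le (M := d.Glued) (I := 𝓘(ℝ, E_P)) (m := 2) (n := ∞)
      (by norm_cast) (IsManifold.subset_maximalAtlas (d.chartA_mem_atlas he))
  have hmem : d.inl a ∈ (d.chartA (chartAt H_A a)).source := ⟨a, mem_chart_source _ a, rfl⟩
  rw [morseIndex_eq_sigNeg_hessianInChart hF hc he2 hmem, morseIndex,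
    sigNeg_eq_of_forall_apply_eq d.linA.symm.toLinearEquiv fun v w =>
      d.hessianInChart_chartA_apply (chartAt H_A a) F a v w,
    hessianInChart_chartAt]

/-- **The Morse index at a critical point `inr b` is that of `F ∘ inr` at `b`.** [cite: Milnor1963, §2] -/
theorem SmoothGlueData.morseIndex_inr_eq {F : d.Glued → ℝ} {b : B}
    (hF : ContMDiffAt 𝓘(ℝ, E_P) 𝓘(ℝ, ℝ) 2 F (d.inr b)) (hc : IsMCriticalPt 𝓘(ℝ, E_P) F (d.inr b)) :
    morseIndex 𝓘(ℝ, E_P) F (d.inr b) = morseIndex I_B (F ∘ d.inr) b := by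
  haveI : IsManifold I_B 2 B := IsManifold.of_le (n := ∞) (by norm_cast)
  have he : chartAt H_B b ∈ IsManifold.maximalAtlas I_B ∞ B := IsManifold.chart_mem_maximalAtlas b
  have he2 : d.chartB (chartAt H_B b) ∈ IsManifold.maximalAtlas 𝓘(ℝ, E_P) 2 d.Glued :=
    IsManifold.maximalAtlas_subset_of_le (M := d.Glued) (I := 𝓘(ℝ, E_P)) (m := 2) (n := ∞)
      (by norm_cast) (IsManifold.subset_maximalAtlas (d.chartB_mem_atlas he))
  have hmem : d.inr b ∈ (d.chartB (chartAt H_B b)).source := ⟨b, mem_chart_source _ b, rfl⟩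
  rw [morseIndex_eq_sigNeg_hessianInChart hF hc he2 hmem, morseIndex,
    sigNeg_eq_of_forall_apply_eq d.linB.symm.toLinearEquiv fun v w =>
      d.hessianInChart_chartB_apply (chartAt H_B b) F b v w,
    hessianInChart_chartAt]

end Glue

end Summit.SmoothPoincare4.SmoothPoincare4.Theorems.AcyclicBisectionRigidity.SeamGluing

end
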